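import Summits.QuantumFields.GaugeBoot.LinkAveraging
import HarnessLib

/-!
# Locality of the action derivative `∂_{i,a}S` on the torus: it ignores links sharing no plaquette with `i`, and it depends on the link `i` unless it vanishes (gauge-boot, L1/L4 supplement)

HONEST FRAMING (cell `pub-gaugeboot`, page 1 of every file): the venture produces certified bounds
on lattice expectations at stated coupling, gauge group, dimension and torus size; NOT a mass gap,
NOT a continuum limit, NOT a string tension; NOT Yang–Mills-summit-bearing (barriers
`FixedCouplingUltralocality`, `PerturbativeInvisibility`). Structural; it certifies no number.

## Content (inputs of `BootstrapCouplingJumpInstance.lean`)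

* `plaqEdges x j j'` — the four links of the plaquette `(x; j, j')`;
  `plaquetteHolonomy_update_of_not_mem` — a plaquette holonomy ignores links off the plaquette;
* ★ `indepOf_torusActionDeriv` — if the link `ℓ ≠ i` shares no plaquette with `i`, the shift
  derivative `∂_{i,a}S` of the Wilson action (`torusActionDeriv`) does not depend on `U_ℓ`
  (`S(U[ℓ ↦ y]_t) - S(U_t)` is constant along the shift at `i`, uniqueness of derivatives);
* ★ `torusActionDeriv_sub_linkAvg_ne_zero` — if `∂_{i,a}S ≠ 0` then `∂_{i,a}S - E_i ∂_{i,a}S ≠ 0`: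
  a non-zero shift derivative DOES depend on the shifted link (otherwise the bounded function
  `t ↦ S(U_t)` would have a constant non-zero derivative).

References: folklore.
-/

noncomputable section

open MeasureTheory Filter Topology NormedSpace
open Literature.MathematicalPhysics.QuantumFieldTheory (LatticeRep Site Edge GaugeConfig plaquetteHolonomy
  wilsonAction haarProbability)
open Literature.MathematicalPhysics.QuantumLattice

namespace Summit.QuantumFields.GaugeBoot

section Torus

variable {d L : ℕ} {G : Type*} [Group G]

/-- **The four links of the plaquette `(x; j, j')`.** [folklore] -/
def plaqEdges (x : Site d L) (j j' : Fin d) : Finset (Edge d L) :=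
  {(x, j), (x.shift j, j'), (x.shift j', j), (x, j')}

/-- **A plaquette holonomy ignores the links off the plaquette.** -/
theorem plaquetteHolonomy_update_of_not_mem {x : Site d L} {j j' : Fin d} {ℓ : Edge d L}
    (h : ℓ ∉ plaqEdges x j j') (U : GaugeConfig d L G) (y : G) :
    plaquetteHolonomy (Function.update U ℓ y) x j j' = plaquetteHolonomy U x j j' := by
  simp only [plaqEdges, Finset.mem_insert, Finset.mem_singleton, not_or] at h
  obtain ⟨h1, h2, h3, h4⟩ := h
  simp only [plaquetteHolonomy, Function.update_of_ne (Ne.symm h1), Function.update_of_ne (Ne.symm h2),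
    Function.update_of_ne (Ne.symm h3), Function.update_of_ne (Ne.symm h4)]

variable [TopologicalSpace G] [IsTopologicalGroup G] [CompactSpace G] [MeasurableSpace G] [BorelSpace G]
  [NeZero L] (r : LatticeRep G) {K : Type*} {k : K → ℝ → G} {X : K → Matrix (Fin r.N) (Fin r.N) ℂ}

omit [TopologicalSpace G] [IsTopologicalGroup G] [CompactSpace G] [MeasurableSpace G] [BorelSpace G] in
/-- **Shifting at `i` and changing a far link `ℓ` decouple in the Wilson action**: if `ℓ ≠ i` and
no plaquette contains both `i` and `ℓ`, then `S(U[i ↦ g U_i][ℓ ↦ y]) - S(U[i ↦ g U_i])` does not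
depend on `g`. -/
theorem wilsonAction_update_update_sub {N : ℕ} (ρ : G →* Matrix (Fin N) (Fin N) ℂ) {i ℓ : Edge d L}
    (hℓi : ℓ ≠ i) (hfar : ∀ (x : Site d L) (j j' : Fin d), i ∈ plaqEdges x j j' → ℓ ∉ plaqEdges x j j')
    (U : GaugeConfig d L G) (y g : G) :
    wilsonAction ρ (Function.update (Function.update U i (g * U i)) ℓ y) -
        wilsonAction ρ (Function.update U i (g * U i)) =
      wilsonAction ρ (Function.update U ℓ y) - wilsonAction ρ U := by
  classical
  unfold wilsonAction
  rw [← Finset.sum_sub_distrib, ← Finset.sum_sub_distrib]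
  refine Finset.sum_congr rfl fun p _ => ?_
  by_cases hi : i ∈ plaqEdges p.1 p.2.1.1 p.2.1.2
  · -- `ℓ` is off this plaquette: both differences vanish
    have hℓ := hfar _ _ _ hi
    rw [plaquetteHolonomy_update_of_not_mem hℓ, plaquetteHolonomy_update_of_not_mem hℓ, sub_self, sub_self]
  · -- `i` is off this plaquette: the shift at `i` is invisible
    rw [Function.update_comm hℓi.symm, plaquetteHolonomy_update_of_not_mem hi,
      plaquetteHolonomy_update_of_not_mem hi]

omit [CompactSpace G] [MeasurableSpace G] [BorelSpace G] in
/-- ★ **The action derivative `∂_{i,a}S` does not depend on a link sharing no plaquette with `i`.**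
[folklore] -/
theorem indepOf_torusActionDeriv (hk : ∀ a s t, k a (s + t) = k a s * k a t)
    (hX : ∀ a t, r.ρ (k a t) = exp ((t : ℂ) • X a)) {i ℓ : Edge d L} (hℓi : ℓ ≠ i)
    (hfar : ∀ (x : Site d L) (j j' : Fin d), i ∈ plaqEdges x j j' → ℓ ∉ plaqEdges x j j') (a : K) :
    IndepOf ℓ (torusActionDeriv r k i a) := by
  intro U y
  set U' := Function.update U ℓ y with hU'
  have h1 := hasDerivAt_torusActionDeriv r hk hX i a U'
  have hUi : U' i = U i := by rw [hU', Function.update_of_ne hℓi.symm]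
  have h2 : (fun t => wilsonAction r.ρ (Function.update U' i (k a t * U' i))) = fun t =>
      wilsonAction r.ρ (Function.update U i (k a t * U i)) +
        (wilsonAction r.ρ (Function.update U ℓ y) - wilsonAction r.ρ U) := by
    funext t
    rw [hUi, hU', Function.update_comm hℓi,
      ← wilsonAction_update_update_sub r.ρ hℓi hfar U y (k a t)]
    ring
  rw [h2] at h1
  have h3 : HasDerivAt (fun t => wilsonAction r.ρ (Function.update U i (k a t * U i)) +
      (wilsonAction r.ρ (Function.update U ℓ y) - wilsonAction r.ρ U))
      (torusActionDeriv r k i a U) 0 :=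
    (hasDerivAt_torusActionDeriv r hk hX i a U).add_const _
  exact h1.unique h3

omit [CompactSpace G] [MeasurableSpace G] [BorelSpace G] in
/-- The action along the shift at `i` has derivative `∂_{i,a}S(U_t)` at every time `t` (one-parameter
family `k a (s + t) = k a s · k a t`). -/
theorem hasDerivAt_wilsonAction_shift (hk : ∀ a s t, k a (s + t) = k a s * k a t)
    (hX : ∀ a t, r.ρ (k a t) = exp ((t : ℂ) • X a)) (i : Edge d L) (a : K) (U : GaugeConfig d L G) (t : ℝ) :
    HasDerivAt (fun s => wilsonAction r.ρ (Function.update U i (k a s * U i)))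
      (torusActionDeriv r k i a (Function.update U i (k a t * U i))) t := by
  set F : ℝ → ℝ := fun s => wilsonAction r.ρ (Function.update U i (k a s * U i)) with hF
  set Ut := Function.update U i (k a t * U i) with hUt
  have h0 := hasDerivAt_torusActionDeriv r hk hX i a Ut
  have heq : (fun s => wilsonAction r.ρ (Function.update Ut i (k a s * Ut i))) = fun s => F (s + t) := by
    funext s
    simp only [hF, hUt, Function.update_self, Function.update_idem, hk, mul_assoc]
  rw [heq] at h0
  have h1 : HasDerivAt (fun x => (fun s => F (s + t)) (x + -t)) (torusActionDeriv r k i a Ut) t :=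
    HasDerivAt.comp_add_const t (-t) (by rw [add_neg_cancel]; exact h0)
  have h2 : (fun x => (fun s => F (s + t)) (x + -t)) = F := by
    funext x
    simp only [neg_add_cancel_right]
  rwa [h2] at h1

omit [MeasurableSpace G] [BorelSpace G] in
/-- ★ **A shift derivative of the action which does not depend on the shifted link vanishes**
(the bounded function `t ↦ S(U_t)` would have the constant derivative `∂_{i,a}S(U)`). -/
theorem torusActionDeriv_eq_zero_of_indepOf (hk : ∀ a s t, k a (s + t) = k a s * k a t)
    (hX : ∀ a t, r.ρ (k a t) = exp ((t : ℂ) • X a)) {i : Edge d L} {a : K}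
    (h : IndepOf i (torusActionDeriv r k i a)) : torusActionDeriv r k i a = 0 := by
  ext U
  set c : ℝ := torusActionDeriv r k i a U with hc
  set F : ℝ → ℝ := fun s => wilsonAction r.ρ (Function.update U i (k a s * U i)) with hF
  have hderiv : ∀ t, HasDerivAt F c t := fun t => by
    have h1 := hasDerivAt_wilsonAction_shift r hk hX i a U t
    rwa [h U (k a t * U i)] at h1
  -- `F t - c t` is constant
  have hd : ∀ t, HasDerivAt (F - fun s => c * s) 0 t := fun t => by
    have h1 := (hderiv t).sub ((hasDerivAt_id t).const_mul c)
    simpa using h1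
  have hconst : ∀ t, F t - c * t = F 0 := fun t => by
    have h1 := is_const_of_deriv_eq_zero (f := F - fun s => c * s)
      (fun s => (hd s).differentiableAt) (fun s => (hd s).deriv) t 0
    simpa using h1
  -- `F` is bounded by the sup norm of the action
  set M : ℝ := ‖wilsonActionCM (d := d) (L := L) r‖ with hM
  have hbd : ∀ t, |F t| ≤ M := fun t => by
    have h1 := (wilsonActionCM (d := d) (L := L) r).norm_coe_le_norm (Function.update U i (k a t * U i))
    rw [Real.norm_eq_abs, coe_wilsonActionCM] at h1
    exact h1
  have hM0 : 0 ≤ M := norm_nonneg _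
  rw [ContinuousMap.zero_apply]
  by_contra hc0
  have ht := hconst ((2 * M + 1) / c)
  have hct : c * ((2 * M + 1) / c) = 2 * M + 1 := mul_div_cancel₀ _ hc0
  rw [hct] at ht
  have h1 := abs_le.1 (hbd ((2 * M + 1) / c))
  have h2 := abs_le.1 (hbd 0)
  linarith [h1.2, h2.1]

/-- ★ **A non-zero shift derivative of the action depends on the shifted link**:
`∂_{i,a}S ≠ 0 ⇒ ∂_{i,a}S - E_i ∂_{i,a}S ≠ 0`. -/
theorem torusActionDeriv_sub_linkAvg_ne_zero (hk : ∀ a s t, k a (s + t) = k a s * k a t)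
    (hX : ∀ a t, r.ρ (k a t) = exp ((t : ℂ) • X a)) {i : Edge d L} {a : K}
    (hS : torusActionDeriv r k i a ≠ 0) :
    torusActionDeriv r k i a - linkAvg i (torusActionDeriv r k i a) ≠ 0 := by
  intro h
  apply hS
  have h1 : torusActionDeriv r k i a = linkAvg i (torusActionDeriv r k i a) := sub_eq_zero.1 h
  refine torusActionDeriv_eq_zero_of_indepOf r hk hX fun U x => ?_
  rw [h1]
  exact indepOf_linkAvg_self i _ U x

end Torus

end Summit.QuantumFields.GaugeBoot

end
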